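import Summits.CriticalPhenomena.PercolationContinuityZ3.Theorems.Transplant.FKConnectivityAllQPat3ShapeOneCone
import HarnessLib

/-!
# Connectivity correlation inequalities for `φ_{w,q}`, every `q > 0` — PIECE-FREE SHAPES (`t = 0`): the exact base checks of
# census g39's recursion as one kernel `decide` per table (census g40)

Definitions + theorems file (`--supports stmt-CriticalPhenomena-4575`), census lineage (gen 40) of LANE 2's FK sub-programme; builds on
p205010 (kernel theorem, internal audit signed; external expert review pending).  No named facts, no sorries; standard axioms.

* `FK.shape0Val_eq_zero` — the piece-free value (`FK.shape0Val`, file `…Pat3ShapeOne.lean`) vanishes above `2|L| + 1`;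
* **`FK.baseCheck0 L ix iy is F`** (`Bool`): `0 ≤ shape0Val … d` for all `d ≤ 2|L| + 1`;
* **`FK.shape0_nonneg_of_check`** — a passed check gives `0 ≤ lev2 (plainSet p L) x y s F μ` at EVERY level `μ` (names injective,
  marks read at `ix iy is`), by `FK.lev2_shape0`.  Users: the bridge row B0 (`…Pat3BridgeB0Data.lean`) and the torso rows / SPGood
  classes with all three marks at vertices.
[cite: AyyerLinussonRavichandran2025, §7 (p. 22)]
-/

namespace Summit.CriticalPhenomena.PercolationContinuityZ3.Theorems

namespace FK

open SimpleGraph Literature.Probability.LatticeModels Literature.Probability.Percolation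
open scoped Classical

variable {V : Type*}

/-! ### Piece-free shapes (t = 0): the exact base checks as one `decide` per table -/

section ShapeZero

variable [Fintype V] {ι : Type*} [DecidableEq ι]

omit [Fintype V] in
/-- The piece-free value vanishes above the structural bound `2|L| + 1`. [folklore] -/
theorem shape0Val_eq_zero (L : List (ι × ι)) (ix iy is : ι) (F : ℕ → Pat3 → Pat3 → ℤ) {d : ℕ} (hd : 2 * L.length + 1 < d) :
    shape0Val L ix iy is F d = 0 := by
  unfold shape0Val
  refine sumBits_eq_zero' L.length fun bs => ?_
  have h1 := (foldBits_snd_le (idMat ι) (zipBits L bs)).trans (length_zipBits_le L bs)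
  have h2 := (foldBits_snd_le (idMat ι) (zipBits L (bs.map (! ·)))).trans (length_zipBits_le L (bs.map (! ·)))
  have e1 : ¬ ((foldBits (idMat ι) (zipBits L bs)).2 + (foldBits (idMat ι) (zipBits L (bs.map (! ·)))).2 = d) := by omega
  have e2 : ¬ ((foldBits (idMat ι) (zipBits L bs)).2 + (foldBits (idMat ι) (zipBits L (bs.map (! ·)))).2 + 1 = d) := by omega
  rw [if_neg e1, if_neg e2, add_zero]

/-- **The exact base check of a piece-free shape**: `F` read on the explicit graph is nonnegative at every residual level
`d ≤ 2|L| + 1` (a `Bool` for `decide`). [folklore] -/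
def baseCheck0 (L : List (ι × ι)) (ix iy is : ι) (F : ℕ → Pat3 → Pat3 → ℤ) : Bool :=
  (List.range (2 * L.length + 2)).all fun d => decide (0 ≤ shape0Val L ix iy is F d)

variable {p : ι → V} {L : List (ι × ι)} {x y s : V} {ix iy is : ι}

/-- **THE EXACT BASE THEOREM** (`t = 0`; census g39's bridge row B0 and the torso rows with all marks at vertices): a passed
`FK.baseCheck0` gives `F` levelwise nonnegative at the marks on the explicit graph (injective names). [folklore] -/
theorem shape0_nonneg_of_check (hinj : Function.Injective p) (hx : p ix = x) (hy : p iy = y) (hs : p is = s)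
    (hL : ∀ e ∈ L, p e.1 ≠ p e.2) (hnd : (L.map (pedge p)).Nodup) {F : ℕ → Pat3 → Pat3 → ℤ}
    (h : baseCheck0 L ix iy is F = true) (μ : ℕ) : 0 ≤ lev2 (plainSet p L) x y s F μ := by
  rw [lev2_shape0 hinj hx hy hs hL hnd F μ]
  split_ifs with hμ
  · by_cases hd : μ + L.length - 2 * Fintype.card V < 2 * L.length + 2
    · unfold baseCheck0 at h
      simp only [List.all_eq_true, decide_eq_true_eq] at h
      exact h _ (List.mem_range.2 hd)
    · rw [shape0Val_eq_zero L ix iy is F (by omega)]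
  · exact le_rfl

end ShapeZero

end FK

end Summit.CriticalPhenomena.PercolationContinuityZ3.Theorems
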